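import Summits.AnomalousDissipation.AnomalousDissipation.Theorems.SolenoidalFractalHomogenisationLagrangianStepTransverseSymbolLipschitz
import Summits.AnomalousDissipation.AnomalousDissipation.Theorems.SolenoidalFractalHomogenisationLagrangianStepW7ThreeModeFibre
import Literature.Analysis.FluidPDE.PassiveVectorTensorTwistedModalSymbol
import HarnessLib

/-!
# K1L_D `LagrangianRenormalisationStepDesign` (stmt-AnomalousDissipation-27980), registered stub `stub_D1_V0thg` (v28, ruling D28-3 (3)), port-map layer L5 input:
# DIRECTION-LIPSCHITZ CONTINUITY OF THE FROZEN-FRAME PROJECTED SYMBOL `Re⟪P^θ_k r, T_{𝔸^{G₀}}(k) P^θ_k y⟫`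
# (helper; `--supports stmt-AnomalousDissipation-27980 --as helper`)

Summits-side helper file of route `SolenoidalFractalHomogenisation` (prover seat `ad-k1l-cellLawV-w1` g9; port map
`Cruxes/LagrangianRenormalisationStepDesign/Lines/onelevel-vtheta-twist-portmap.md` §3 L5, ruling D28-7).  The frozen-frame twin of
`…TransverseSymbolLipschitz.abs_re_inner_symbT_proj_sub_le` — the one analytic input of the defect algebra `…SidebandXDefectAlgebra` (viscous ξ-defect pairing).
The conjugated tensor `𝔸^{G₀} = Visc4.conj G₀ 𝔸` has the flat bilinear symbol at the twisted covector (`bsymb_conj`), and the twisted projection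
`P^θ_k = transversalProjR (twistFreq G₀ k)` acts on real and imaginary parts by the real Leray map `lerayR (twistFreq G₀ k)` of `…TransverseSymbolLipschitz`,
so `abs_bsymb_lerayR_sub_le` (stated there for REAL wave vectors) applies verbatim at `q₀ = G₀ᵀk₀`, `δ = G₀ᵀ(k − k₀)`.  Everything proved; no definitions,
no named facts, no sorry.
* `bsymb_conj` — `β_{𝔸^{M}}(ξ; p, q) = β_𝔸(Mᵀξ; p, q)`; `re_inner_symbT_conj_bilin` — `Re⟪u, T_{𝔸^{M}}(k) w⟫ = β_𝔸(Mᵀk; Re w, Re u) + β_𝔸(Mᵀk; Im w, Im u)`;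
* `re_transversalProjR`, `im_transversalProjR` — `P_q` acts on real/imaginary parts by `lerayR q`;
* **`abs_re_inner_symbT_conj_projR_sub_le`** — for integer `k, k₀` with `0 < |G₀ᵀk₀|²` and `4|G₀ᵀ(k − k₀)|² ≤ |G₀ᵀk₀|²`, ALL `r, y ∈ ℂ³`, `K₀` any transverse bound
  of `β_𝔸`: `|Re⟪P^θ_k r, T^θ(k) P^θ_k y⟫ − Re⟪P^θ_{k₀} r, T^θ(k₀) P^θ_{k₀} y⟫| ≤ 534·K₀·|G₀ᵀk₀|·|G₀ᵀ(k − k₀)|·‖y‖·‖r‖`.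
At `G₀ = 1` this is `abs_re_inner_symbT_proj_sub_le` (`twistFreq_one`, `transversalProjR_intCast`, `conj_one`).
NOT a proof of any registered stub, of the crux, or of anomalous dissipation; rung F-D1 infrastructure for the `stub_D1_V0thg` engine.
-/

set_option linter.dupNamespace false

noncomputable section

namespace Summit.AnomalousDissipation.AnomalousDissipation.Theorems.SolenoidalFractalHomogenisation.LagrangianStep.SymbolLipschitz

open Finset
open scoped InnerProductSpace
open Literature.Analysis Literature.Analysis.FluidPDE Literature.Analysis.FluidPDE.Torus
open Literature.Analysis.FunctionSpaces.Torus (freqNormSq)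

/-! ## §1 The conjugated bilinear symbol and the real/imaginary parts of the twisted projection -/

/-- **`β_{𝔸^{M}}(ξ; p, q) = β_𝔸(Mᵀξ; p, q)`**, `(Mᵀξ)_a = (ξ ᵥ* M)_a`. [cite: ArmstrongVicol2025, §4.1 (PDF p. 34)] [cite: Giaquinta1983MultipleIntegrals, Ch. III §2 eq. (2.1)-(2.2)] -/
theorem bsymb_conj (M : Matrix (Fin 3) (Fin 3) ℝ) (𝔸 : Visc4 (Fin 3)) (ξ p q : Fin 3 → ℝ) :
    bsymb (Visc4.conj M 𝔸) ξ p q = bsymb 𝔸 (Matrix.vecMul ξ M) p q := by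
  simp only [bsymb, Visc4.conj_apply, Matrix.vecMul, dotProduct]
  have lhs : ∑ i, ∑ c, ∑ j, ∑ e, (∑ a, ∑ b, M c a * 𝔸 i a j b * M e b) * p i * ξ c * q j * ξ e =
      ∑ i, ∑ c, ∑ j, ∑ e, ∑ a, ∑ b, M c a * 𝔸 i a j b * M e b * p i * ξ c * q j * ξ e := by
    simp only [Finset.sum_mul]
  have e1 : ∀ i a j b, 𝔸 i a j b * p i * (∑ c, ξ c * M c a) * q j * (∑ e, ξ e * M e b) =
      (𝔸 i a j b * p i * q j) * ((∑ c, ξ c * M c a) * (∑ e, ξ e * M e b)) := by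
    intros; ring
  have rhs : ∑ i, ∑ a, ∑ j, ∑ b, 𝔸 i a j b * p i * (∑ c, ξ c * M c a) * q j * (∑ e, ξ e * M e b) =
      ∑ i, ∑ a, ∑ j, ∑ b, ∑ c, ∑ e, M c a * 𝔸 i a j b * M e b * p i * ξ c * q j * ξ e := by
    simp_rw [e1, Finset.sum_mul_sum, Finset.mul_sum]
    exact Finset.sum_congr rfl fun i _ => Finset.sum_congr rfl fun a _ => Finset.sum_congr rfl fun j _ =>
      Finset.sum_congr rfl fun b _ => Finset.sum_congr rfl fun c _ => Finset.sum_congr rfl fun e _ => by ring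
  rw [lhs, rhs]
  -- reindex the six-fold sum `Σ_i Σ_c Σ_j Σ_e Σ_a Σ_b = Σ_i Σ_a Σ_j Σ_b Σ_c Σ_e`
  refine Finset.sum_congr rfl fun i _ => ?_
  calc ∑ c, ∑ j, ∑ e, ∑ a, ∑ b, M c a * 𝔸 i a j b * M e b * p i * ξ c * q j * ξ e
      = ∑ c, ∑ j, ∑ a, ∑ e, ∑ b, M c a * 𝔸 i a j b * M e b * p i * ξ c * q j * ξ e :=
        Finset.sum_congr rfl fun c _ => Finset.sum_congr rfl fun j _ => Finset.sum_comm
    _ = ∑ c, ∑ j, ∑ a, ∑ b, ∑ e, M c a * 𝔸 i a j b * M e b * p i * ξ c * q j * ξ e :=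
        Finset.sum_congr rfl fun c _ => Finset.sum_congr rfl fun j _ => Finset.sum_congr rfl fun a _ => Finset.sum_comm
    _ = ∑ c, ∑ a, ∑ j, ∑ b, ∑ e, M c a * 𝔸 i a j b * M e b * p i * ξ c * q j * ξ e := Finset.sum_congr rfl fun c _ => Finset.sum_comm
    _ = ∑ a, ∑ c, ∑ j, ∑ b, ∑ e, M c a * 𝔸 i a j b * M e b * p i * ξ c * q j * ξ e := Finset.sum_comm
    _ = ∑ a, ∑ j, ∑ c, ∑ b, ∑ e, M c a * 𝔸 i a j b * M e b * p i * ξ c * q j * ξ e := Finset.sum_congr rfl fun a _ => Finset.sum_comm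
    _ = ∑ a, ∑ j, ∑ b, ∑ c, ∑ e, M c a * 𝔸 i a j b * M e b * p i * ξ c * q j * ξ e :=
        Finset.sum_congr rfl fun a _ => Finset.sum_congr rfl fun j _ => Finset.sum_comm

/-- **Bilinear twisted symbol identity**: `Re⟪u, T_{𝔸^{M}}(k) w⟫ = β_𝔸(Mᵀk; Re w, Re u) + β_𝔸(Mᵀk; Im w, Im u)`.
[cite: Frisch1995Turbulence, §9.6.3 eq. (9.57) p. 233] [cite: ArmstrongVicol2025, §4.1 (PDF p. 34)] -/
theorem re_inner_symbT_conj_bilin (M : Matrix (Fin 3) (Fin 3) ℝ) (𝔸 : Visc4 (Fin 3)) (k : Fin 3 → ℤ) (u w : EuclideanSpace ℂ (Fin 3)) :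
    (⟪u, symbT (Visc4.conj M 𝔸) k w⟫_ℂ).re
      = bsymb 𝔸 (twistFreq M k) (fun i => (w i).re) (fun j => (u j).re)
        + bsymb 𝔸 (twistFreq M k) (fun i => (w i).im) (fun j => (u j).im) := by
  rw [ThreeMode.re_inner_symbT_bilin, bsymb_conj, bsymb_conj, twistFreq_eq_vecMul]

/-- **The twisted projection acts on real parts by `π_q`** (`q` a real wave vector). [cite: Temam1984, Ch. III §1.1] -/
theorem re_transversalProjR (q : Fin 3 → ℝ) (z : EuclideanSpace ℂ (Fin 3)) (i : Fin 3) :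
    (transversalProjR q z i).re = lerayR q (fun j => (z j).re) i := by
  have hc : ((((∑ j, q j ^ 2 : ℝ) : ℂ))⁻¹ * rdot q z).re = (∑ j, (z j).re * q j) / ∑ j, q j ^ 2 := by
    rw [rdot_apply, ← Complex.ofReal_inv, Complex.re_ofReal_mul, Complex.re_sum, div_eq_inv_mul]
    congr 1
    refine Finset.sum_congr rfl fun j _ => ?_
    rw [Complex.re_ofReal_mul, mul_comm]
  rw [transversalProjR_apply, PiLp.sub_apply, PiLp.smul_apply, waveVecRC_apply, smul_eq_mul, Complex.sub_re, Complex.re_mul_ofReal, hc]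
  simp only [lerayR, dotR, nsqR]

/-- **The twisted projection acts on imaginary parts by `π_q`.** [cite: Temam1984, Ch. III §1.1] -/
theorem im_transversalProjR (q : Fin 3 → ℝ) (z : EuclideanSpace ℂ (Fin 3)) (i : Fin 3) :
    (transversalProjR q z i).im = lerayR q (fun j => (z j).im) i := by
  have h := re_transversalProjR q ((-Complex.I) • z) i
  simp only [map_smul, PiLp.smul_apply, smul_eq_mul, re_neg_I_mul] at h
  exact h

/-! ## §2 Direction-Lipschitz continuity of the twisted projected symbol -/

/-- **DIRECTION-LIPSCHITZ CONTINUITY OF `Re⟪P^θ_k r, T_{𝔸^{G₀}}(k) P^θ_k y⟫` FROM TRANSVERSE DATA** (integer modes `k, k₀`, twisted covectors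
`q = G₀ᵀk`, `q₀ = G₀ᵀk₀` with `0 < |q₀|²`, `4|q − q₀|² ≤ |q₀|²`; ALL `r, y ∈ ℂ³`; `K₀` any transverse bound of the flat bilinear symbol of `𝔸`):
`|Re⟪P^θ_k r, T^θ(k) P^θ_k y⟫ − Re⟪P^θ_{k₀} r, T^θ(k₀) P^θ_{k₀} y⟫| ≤ 534·K₀·|q₀|·|q − q₀|·‖y‖·‖r‖`. [folklore] -/
theorem abs_re_inner_symbT_conj_projR_sub_le {𝔸 : Visc4 (Fin 3)} {K₀ : ℝ} (hK₀ : 0 ≤ K₀)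
    (hK : ∀ k p q : Fin 3 → ℝ, ∑ i, p i * k i = 0 → ∑ i, q i * k i = 0 →
      |bsymb 𝔸 k p q| ≤ K₀ * (∑ a, k a ^ 2) * (Real.sqrt (∑ i, p i ^ 2) * Real.sqrt (∑ i, q i ^ 2)))
    (G₀ : Matrix (Fin 3) (Fin 3) ℝ) (k k₀ : Fin 3 → ℤ) (hk₀ : 0 < nsqR (twistFreq G₀ k₀))
    (hclose : 4 * nsqR (twistFreq G₀ (k - k₀)) ≤ nsqR (twistFreq G₀ k₀)) (r y : EuclideanSpace ℂ (Fin 3)) :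
    |(⟪transversalProjR (twistFreq G₀ k) r, symbT (Visc4.conj G₀ 𝔸) k (transversalProjR (twistFreq G₀ k) y)⟫_ℂ).re
        - (⟪transversalProjR (twistFreq G₀ k₀) r, symbT (Visc4.conj G₀ 𝔸) k₀ (transversalProjR (twistFreq G₀ k₀) y)⟫_ℂ).re|
      ≤ 534 * K₀ * Real.sqrt (nsqR (twistFreq G₀ k₀)) * Real.sqrt (nsqR (twistFreq G₀ (k - k₀))) * (‖y‖ * ‖r‖) := by
  -- real and imaginary parts
  set yr : Fin 3 → ℝ := fun j => (y j).re
  set yi : Fin 3 → ℝ := fun j => (y j).im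
  set rr : Fin 3 → ℝ := fun j => (r j).re
  set ri : Fin 3 → ℝ := fun j => (r j).im
  have hre : ∀ κ : Fin 3 → ℤ, (⟪transversalProjR (twistFreq G₀ κ) r,
      symbT (Visc4.conj G₀ 𝔸) κ (transversalProjR (twistFreq G₀ κ) y)⟫_ℂ).re
      = bsymb 𝔸 (twistFreq G₀ κ) (lerayR (twistFreq G₀ κ) yr) (lerayR (twistFreq G₀ κ) rr)
        + bsymb 𝔸 (twistFreq G₀ κ) (lerayR (twistFreq G₀ κ) yi) (lerayR (twistFreq G₀ κ) ri) := by
    intro κ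
    rw [re_inner_symbT_conj_bilin]
    have e1 : (fun i => (transversalProjR (twistFreq G₀ κ) y i).re) = lerayR (twistFreq G₀ κ) yr := funext (re_transversalProjR _ y)
    have e2 : (fun j => (transversalProjR (twistFreq G₀ κ) r j).re) = lerayR (twistFreq G₀ κ) rr := funext (re_transversalProjR _ r)
    have e3 : (fun i => (transversalProjR (twistFreq G₀ κ) y i).im) = lerayR (twistFreq G₀ κ) yi := funext (im_transversalProjR _ y)
    have e4 : (fun j => (transversalProjR (twistFreq G₀ κ) r j).im) = lerayR (twistFreq G₀ κ) ri := funext (im_transversalProjR _ r)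
    rw [e1, e2, e3, e4]
  rw [hre k, hre k₀]
  have hkk : twistFreq G₀ k = twistFreq G₀ k₀ + twistFreq G₀ (k - k₀) := by
    rw [← twistFreq_add]; congr 1; abel
  have h1 := abs_bsymb_lerayR_sub_le hK₀ hK (twistFreq G₀ k₀) (twistFreq G₀ (k - k₀)) yr rr hk₀ hclose
  have h2 := abs_bsymb_lerayR_sub_le hK₀ hK (twistFreq G₀ k₀) (twistFreq G₀ (k - k₀)) yi ri hk₀ hclose
  rw [← hkk] at h1 h2
  have hsum := ThreeMode.sqrt_mul_add_sqrt_mul_le (a := ∑ i, yr i ^ 2) (b := ∑ i, yi i ^ 2) (c := ∑ i, rr i ^ 2) (d := ∑ i, ri i ^ 2)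
    (by positivity) (by positivity) (by positivity) (by positivity)
  have hy : Real.sqrt (∑ i, yr i ^ 2 + ∑ i, yi i ^ 2) = ‖y‖ := by
    rw [← ThreeMode.norm_sq_re_im y, Real.sqrt_sq (norm_nonneg _)]
  have hr : Real.sqrt (∑ i, rr i ^ 2 + ∑ i, ri i ^ 2) = ‖r‖ := by
    rw [← ThreeMode.norm_sq_re_im r, Real.sqrt_sq (norm_nonneg _)]
  rw [hy, hr] at hsum
  have hC : 0 ≤ 534 * K₀ * Real.sqrt (nsqR (twistFreq G₀ k₀)) * Real.sqrt (nsqR (twistFreq G₀ (k - k₀))) := by positivity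
  set q := twistFreq G₀ k
  set q₀ := twistFreq G₀ k₀
  calc |bsymb 𝔸 q (lerayR q yr) (lerayR q rr) + bsymb 𝔸 q (lerayR q yi) (lerayR q ri)
        - (bsymb 𝔸 q₀ (lerayR q₀ yr) (lerayR q₀ rr) + bsymb 𝔸 q₀ (lerayR q₀ yi) (lerayR q₀ ri))|
      = |(bsymb 𝔸 q (lerayR q yr) (lerayR q rr) - bsymb 𝔸 q₀ (lerayR q₀ yr) (lerayR q₀ rr))
        + (bsymb 𝔸 q (lerayR q yi) (lerayR q ri) - bsymb 𝔸 q₀ (lerayR q₀ yi) (lerayR q₀ ri))| := by ring_nf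
    _ ≤ |bsymb 𝔸 q (lerayR q yr) (lerayR q rr) - bsymb 𝔸 q₀ (lerayR q₀ yr) (lerayR q₀ rr)|
        + |bsymb 𝔸 q (lerayR q yi) (lerayR q ri) - bsymb 𝔸 q₀ (lerayR q₀ yi) (lerayR q₀ ri)| := abs_add_le _ _
    _ ≤ 534 * K₀ * Real.sqrt (nsqR q₀) * Real.sqrt (nsqR (twistFreq G₀ (k - k₀))) * (Real.sqrt (∑ i, yr i ^ 2) * Real.sqrt (∑ i, rr i ^ 2))
        + 534 * K₀ * Real.sqrt (nsqR q₀) * Real.sqrt (nsqR (twistFreq G₀ (k - k₀))) * (Real.sqrt (∑ i, yi i ^ 2) * Real.sqrt (∑ i, ri i ^ 2)) :=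
        add_le_add h1 h2
    _ = 534 * K₀ * Real.sqrt (nsqR q₀) * Real.sqrt (nsqR (twistFreq G₀ (k - k₀)))
        * (Real.sqrt (∑ i, yr i ^ 2) * Real.sqrt (∑ i, rr i ^ 2) + Real.sqrt (∑ i, yi i ^ 2) * Real.sqrt (∑ i, ri i ^ 2)) := by ring
    _ ≤ 534 * K₀ * Real.sqrt (nsqR q₀) * Real.sqrt (nsqR (twistFreq G₀ (k - k₀))) * (‖y‖ * ‖r‖) :=
        mul_le_mul_of_nonneg_left hsum hC

end Summit.AnomalousDissipation.AnomalousDissipation.Theorems.SolenoidalFractalHomogenisation.LagrangianStep.SymbolLipschitz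

end
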